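import Literature.AlgebraicGeometry.AbelianSchemes.ArtinLocalFibreProjectiveCover
import HarnessLib

/-!
# The closed fibre of an abelian scheme as an EXPLICIT base change, and a principal affine cover lifted from it

Topic `Literature/AlgebraicGeometry/AbelianSchemes`; THEOREMS ONLY (no definition, no instance, no notation, no named fact,
no `sorry`).  Cell `hodgecm-mathlib` (FLOOR 0), programme P1b, F-11 road A, grandchild `F11LiftWithLineBundle`, letter G1-P
`stub_abelianLift`: the «closed fibre + cover» input of the MONO-G1 integrator in its EXPLICIT form.

The tree's `AbelianSchemeOver.exists_closedFibre_principal_affine_cover` ([Hartshorne2010] Thm. 10.2 (a), proof, p. 81 /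
[MumfordFogartyKirwan1994] Ch. 6 §3 p. 125) returns the closed fibre of an abelian scheme `A₀ → Spec R` along a `k`-algebra
retraction `π : R → k` with nilpotent kernel as an ABSTRACT `k`-scheme `X` with a cartesian closed immersion `i₀ : X ↪ A₀`.
Its proof takes `X := A₀ ×_R Spec k` — the base change `A₀.baseChange (Spec k → Spec R)`, which is again an ABELIAN SCHEME
(over the field `k`), and `i₀ := pr₁`.  Consumers that need the GROUP structure of the closed fibre (the frame of its tangent
sheaf by invariant vector fields, [MumfordAV1970] §4 (iii); multiplication by `n`) want exactly this literal instance, not an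
abstract `X`.  This file re-runs the same four tree steps with the fibre kept explicit:

* `isClosedImmersion_fst_baseChange_of_surjective` — `pr₁ : A₀ ×_R k → A₀` is a closed immersion ([GortzWedhorn2020] Prop. 4.20:
  base change of the closed immersion `Spec k ↪ Spec R`);
* `isNilpotent_ker_fst_baseChange` — its kernel ideal is nilpotent when `ker π` is ([StacksProject] Tag 04EX; the tree's
  `Morphisms.isNilpotent_ker_of_isPullback_specMap`);
* `exists_principal_affine_cover_closedFibre_baseChange` — a FINITE principal affine cover `(U', b')` of `A₀`
  (`U' j ∩ U' l = D(b'_{jl})`, covering — both as `IsOpenCover` and as `⨆ = ⊤`) whose trace `U j = pr₁⁻¹ U' j` on the closed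
  fibre `A₀ ×_R k` is a principal affine cover `(U, b)` of this projective `k`-scheme ([Hartshorne1977] II Prop. 2.5 (b);
  [StacksProject] Tag 06AD: affine opens and principal sections lift along a nilpotent thickening — the tree's
  `Morphisms.exists_principal_affine_cover_of_isProjective`, `AbelianSchemeOver.isProjective_baseChange_hom_of_field`,
  `Morphisms.exists_principal_affine_cover_lift`, `Morphisms.preimage_injective_of_isNilpotent_ker`);
* `exists_closedFibre_principal_affine_cover_explicit` — the same together with the canonical section algebras, i.e. the
  tree's `exists_closedFibre_principal_affine_cover` with its witnesses exposed, in the MONO-G1 integrator's binder order.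

## References
* [Hartshorne2010] R. Hartshorne, *Deformation Theory*, GTM 257 (2010), Thm. 10.2 (a), proof (p. 81).
* [MumfordFogartyKirwan1994] D. Mumford, J. Fogarty, F. Kirwan, *Geometric Invariant Theory*, 3rd ed. (1994), Ch. 6 §3
  Prop. 6.15 (p. 124) and its proof (p. 125).
* [MumfordAV1970] D. Mumford, *Abelian Varieties* (1970), §4 (iii) (p. 42), §6 Application 1 (pp. 60–61).
* [Hartshorne1977] R. Hartshorne, *Algebraic Geometry*, GTM 52 (1977), II Prop. 2.5 (pp. 76–77).
* [GortzWedhorn2020] U. Görtz, T. Wedhorn, *Algebraic Geometry I*, 2nd ed. (2020), Prop. 4.20 (p. 104).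
* [StacksProject] The Stacks Project, Tag 06AD, Tag 04EX.
-/

noncomputable section

-- Mathlib's `Over` API and `Scheme.Modules` section API are stated across semireducible wrappers.
set_option backward.isDefEq.respectTransparency false

open CategoryTheory CategoryTheory.Limits AlgebraicGeometry TopologicalSpace Opposite
open Literature.AlgebraicGeometry.Modules Literature.AlgebraicGeometry.Motives

universe u

namespace Literature.AlgebraicGeometry.AbelianSchemes

namespace AbelianSchemeOver

section ClosedFibreBaseChange

variable {k R : Type u} [Field k] [CommRing R] [Algebra k R] (π : R →ₐ[k] k)

/-- **`pr₁ : A₀ ×_R Spec k → A₀` is a closed immersion** for `π : R → k` a `k`-algebra retraction (so `π` is onto and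
`Spec k ↪ Spec R` is a closed immersion; closed immersions are stable under base change).
[cite: GortzWedhorn2020, Prop. 4.20 (p. 104)] -/
theorem isClosedImmersion_fst_baseChange_of_retraction (A₀ : AbelianSchemeOver (Spec (.of R))) :
    IsClosedImmersion (pullback.fst A₀.X.hom (Spec.map (CommRingCat.ofHom π.toRingHom))) := by
  have hsurj : Function.Surjective π.toRingHom := fun x ↦ ⟨algebraMap k R x, π.commutes x⟩
  exact MorphismProperty.of_isPullback
    (IsPullback.of_hasPullback A₀.X.hom (Spec.map (CommRingCat.ofHom π.toRingHom))).flip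
    (IsClosedImmersion.spec_of_surjective _ hsurj)

/-- **The kernel ideal of `pr₁ : A₀ ×_R Spec k ↪ A₀` is nilpotent** when `ker π` is nilpotent (`π : R → k` a `k`-algebra
retraction): the closed fibre is a nilpotent thickening's reduction of `A₀` ([StacksProject] Tag 04EX; the tree's
`Morphisms.isNilpotent_ker_of_isPullback_specMap` applied to the cartesian square of the base change).
[cite: StacksProject, Tag 04EX] -/
theorem isNilpotent_ker_fst_baseChange (hπnil : IsNilpotent (RingHom.ker π))
    (A₀ : AbelianSchemeOver (Spec (.of R))) :
    IsNilpotent (pullback.fst A₀.X.hom (Spec.map (CommRingCat.ofHom π.toRingHom))).ker := by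
  have hsurj : Function.Surjective π.toRingHom := fun x ↦ ⟨algebraMap k R x, π.commutes x⟩
  haveI := isClosedImmersion_fst_baseChange_of_retraction π A₀
  exact Morphisms.isNilpotent_ker_of_isPullback_specMap π.toRingHom hsurj hπnil
    (IsPullback.of_hasPullback A₀.X.hom (Spec.map (CommRingCat.ofHom π.toRingHom)))

/-- **A principal affine cover of an abelian scheme lifted from its EXPLICIT closed fibre** ([Hartshorne2010] Thm. 10.2 (a),
proof, p. 81 / [MumfordFogartyKirwan1994] Ch. 6 §3, p. 125).  For `π : R → k` a `k`-algebra retraction with NILPOTENT kernel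
and `A₀ → Spec R` an abelian scheme, write `s := Spec π : Spec k → Spec R` and `A₀.baseChange s` for the closed fibre (an
abelian scheme over the field `k`, whose underlying `k`-scheme `(A₀.baseChange s).X = A₀ ×_R Spec k` is projective —
[MumfordAV1970] §6 Application 1, the tree's `isProjective_baseChange_hom_of_field`).  Then there is a FINITE principal affine
cover `(U', b')` of `A₀` (`U' j ∩ U' l = D(b'_{jl})`, covering `A₀` — stated both as `IsOpenCover` and as `⨆ j, U' j = ⊤`)
whose trace `U j = pr₁⁻¹ U' j` on `A₀ ×_R Spec k` is a principal affine cover `(U, b)` ([Hartshorne1977] II Prop. 2.5 (b)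
for the projective `k`-scheme; [StacksProject] Tag 06AD: affine opens and principal sections lift along the nilpotent
thickening `pr₁`); the last clause is the body of the `∃`.  Same content as the tree's
`exists_closedFibre_principal_affine_cover`, with the fibre `X := (A₀.baseChange s).X` and `i₀ := pullback.fst` kept
LITERAL so that consumers may use the group structure of `A₀.baseChange s`.
[cite: Hartshorne2010, Thm. 10.2 (proof), p. 81] [cite: StacksProject, Tag 06AD]
[cite: Hartshorne1977, II Prop. 2.5 (b) and proof (pp. 76–77)]
[cite: MumfordFogartyKirwan1994, Ch. 6 §3 Prop. 6.15 (p. 124) and its proof (p. 125)] -/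
theorem exists_principal_affine_cover_closedFibre_baseChange (hπnil : IsNilpotent (RingHom.ker π))
    (A₀ : AbelianSchemeOver (Spec (.of R))) :
    ∃ (ι : Type u) (_ : Finite ι) (U' : ι → A₀.X.left.affineOpens) (b' : (j l : ι) → Γ(A₀.X.left, (U' j).1))
      (_ : ∀ j l, (U' j).1 ⊓ (U' l).1 = A₀.X.left.basicOpen (b' j l)) (_ : IsOpenCover fun j => (U' j).1)
      (_ : ⨆ j, (U' j).1 = ⊤)
      (U : ι → (A₀.baseChange (Spec.map (CommRingCat.ofHom π.toRingHom))).X.left.affineOpens)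
      (_ : ∀ j, (U j).1 = (pullback.fst A₀.X.hom (Spec.map (CommRingCat.ofHom π.toRingHom)) :
        (A₀.baseChange (Spec.map (CommRingCat.ofHom π.toRingHom))).X.left ⟶ A₀.X.left) ⁻¹ᵁ (U' j).1)
      (b : (j l : ι) → Γ((A₀.baseChange (Spec.map (CommRingCat.ofHom π.toRingHom))).X.left, (U j).1)),
      ∀ j l, (U j).1 ⊓ (U l).1 =
        (A₀.baseChange (Spec.map (CommRingCat.ofHom π.toRingHom))).X.left.basicOpen (b j l) := by
  -- the closed fibre `X := A₀ ×_R Spec k` and `i₀ := pr₁`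
  let s : Spec (.of k) ⟶ Spec (.of R) := Spec.map (CommRingCat.ofHom π.toRingHom)
  let X : Over (Spec (.of k)) := (A₀.baseChange s).X
  let i₀ : X.left ⟶ A₀.X.left := pullback.fst A₀.X.hom s
  -- a finite principal affine cover of the projective `k`-scheme `X` (an abelian variety)
  obtain ⟨ι, hι, U, b, hcov, hb⟩ :=
    Morphisms.exists_principal_affine_cover_of_isProjective (isProjective_baseChange_hom_of_field π A₀)
  -- `i₀` is a closed immersion with nilpotent kernel ideal
  haveI : IsClosedImmersion i₀ := isClosedImmersion_fst_baseChange_of_retraction π A₀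
  have hnil : IsNilpotent i₀.ker := isNilpotent_ker_fst_baseChange π hπnil A₀
  -- lift the cover to `A₀` along the nilpotent thickening `i₀`; the lift covers
  obtain ⟨U', b', hU', hb'⟩ := Morphisms.exists_principal_affine_cover_lift i₀ hnil U b hb
  have hU'cov : ⨆ j, (U' j).1 = ⊤ := by
    refine Morphisms.preimage_injective_of_isNilpotent_ker i₀ hnil ?_
    rw [Scheme.Hom.preimage_iSup, Scheme.Hom.preimage_top]
    simp_rw [hU']
    exact hcov
  exact ⟨ι, hι, U', b', hb', hU'cov, hU'cov, U, fun j ↦ (hU' j).symm, b, hb⟩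

/-- **The tree's `exists_closedFibre_principal_affine_cover` WITH ITS WITNESSES EXPOSED** — the closed fibre is LITERALLY
`(A₀.baseChange (Spec π)).X` and `i₀ = pullback.fst`; the canonical `k`-, resp. `R`-algebra structures on sections
(`Motives.constToPresheaf`, compatibilities `rfl`) are returned in the `∃` in the binder order of the MONO-G1 integrator
(F0P1b-p06's cert v3 states this verbatim), followed by the principal affine cover `(U', b')` of `A₀` and its trace `(U, b)`
on the closed fibre (`exists_principal_affine_cover_closedFibre_baseChange`).
[cite: Hartshorne2010, Thm. 10.2 (proof), p. 81]
[cite: MumfordFogartyKirwan1994, Ch. 6 §3 Prop. 6.15 (p. 124) and its proof (p. 125)] -/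
theorem exists_closedFibre_principal_affine_cover_explicit (hπnil : IsNilpotent (RingHom.ker π))
    (A₀ : AbelianSchemeOver (Spec (.of R))) :
    ∃ (_ : ∀ W : (A₀.baseChange (Spec.map (CommRingCat.ofHom π.toRingHom))).X.left.Opens,
        Algebra k Γ((A₀.baseChange (Spec.map (CommRingCat.ofHom π.toRingHom))).X.left, W))
      (_ : ∀ (W : (A₀.baseChange (Spec.map (CommRingCat.ofHom π.toRingHom))).X.left.Opens) (s : k),
        algebraMap k Γ((A₀.baseChange (Spec.map (CommRingCat.ofHom π.toRingHom))).X.left, W) s =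
          (constToPresheaf (A₀.baseChange (Spec.map (CommRingCat.ofHom π.toRingHom))).X).app (op W) s)
      (_ : ∀ W : A₀.X.left.Opens, Algebra R Γ(A₀.X.left, W))
      (_ : ∀ (W : A₀.X.left.Opens) (a : R), algebraMap R Γ(A₀.X.left, W) a = (constToPresheaf A₀.X).app (op W) a)
      (ι : Type u) (_ : Finite ι) (U' : ι → A₀.X.left.affineOpens) (b' : (j l : ι) → Γ(A₀.X.left, (U' j).1))
      (_ : ∀ j l, (U' j).1 ⊓ (U' l).1 = A₀.X.left.basicOpen (b' j l)) (_ : IsOpenCover fun j => (U' j).1)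
      (_ : ⨆ j, (U' j).1 = ⊤)
      (U : ι → (A₀.baseChange (Spec.map (CommRingCat.ofHom π.toRingHom))).X.left.affineOpens)
      (_ : ∀ j, (U j).1 = (pullback.fst A₀.X.hom (Spec.map (CommRingCat.ofHom π.toRingHom))) ⁻¹ᵁ (U' j).1)
      (b : (j l : ι) → Γ((A₀.baseChange (Spec.map (CommRingCat.ofHom π.toRingHom))).X.left, (U j).1)),
      ∀ j l, (U j).1 ⊓ (U l).1 = (A₀.baseChange (Spec.map (CommRingCat.ofHom π.toRingHom))).X.left.basicOpen (b j l) := by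
  obtain ⟨ι, hι, U', b', hb', hU'cov, hU'top, U, hU, b, hb⟩ :=
    exists_principal_affine_cover_closedFibre_baseChange π hπnil A₀
  exact ⟨fun W ↦ ((constToPresheaf (A₀.baseChange (Spec.map (CommRingCat.ofHom π.toRingHom))).X).app (op W)).hom.toAlgebra,
    fun W c ↦ rfl, fun W ↦ ((constToPresheaf A₀.X).app (op W)).hom.toAlgebra, fun W a ↦ rfl,
    ι, hι, U', b', hb', hU'cov, hU'top, U, hU, b, hb⟩

end ClosedFibreBaseChange

end AbelianSchemeOver

end Literature.AlgebraicGeometry.AbelianSchemes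

end
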